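import Summits.Ventures.HSemireg.WedgeHankelRecurrenceGaussOrthogonalUnique

/-!
# Venture HSemireg — **EXISTENCE OF THE GAUSS–JACOBI RULE FOR EVERY POSITIVE DISCRETE MEASURE** (capstone of the chapter): for `ν_l > 0` on `N` distinct nodes `w_l` and `t + 1 < N`, the
# orthogonal polynomial `q_{t+1}` (Gram–Schmidt, N289) has `t + 1` strictly increasing real zeros `z_0 < ⋯ < z_t` (the local three-term recurrences of N273 are spliced into a global positive
# recurrence and N279 applies), and the rule on these zeros with the Christoffel weights `λ_k = Σ_l ν_l ℓ_k(w_l)` is EXACT in degree `≤ 2t + 1` with ALL WEIGHTS POSITIVE (N265)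

HONEST FRAMING. Part of the Lean index of the computation cell `pub-hsemireg` (seat p10 gen 42, Sunday typer «UNIFORM-IN-n»).  Real polynomials and finite sums only (a recurrence-defined
sequence via `Nat.rec` inside the proof); no variety, no cohomology theory, no sheaf, no Ext group and no semiregularity map is constructed here; nothing here says that HC / HC_CM / HC_AV
holds; no Literature fact (unproved `Prop`) is declared or used.  Custodian versions as in `WedgeHankelSiegelIdeal` (1/3).
SOURCES (cited).  C. F. Gauss, *Methodus nova integralium valores per approximationem inveniendi* (1814); C. G. J. Jacobi, J. reine angew. Math. 1 (1826) 301–308; G. Szegő, *Orthogonal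
Polynomials*, Thm 3.3.1 (real simple zeros in the interior of the support interval) and Thm 3.4.1–3.4.2 (Gauss–Jacobi mechanical quadrature, positive Christoffel numbers); T. S. Chihara,
*An Introduction to Orthogonal Polynomials* (1978), Ch. I Thm 5.2 ∕ Thm 6.1–6.2; F. R. Gantmacher, *The Theory of Matrices* II, Ch. XV §16 Thm 18 (the Stieltjes case, typed N235).
PROOF TYPED HERE.  N289 gives `q_0, …, q_n` (`n = t + 1`); N273 gives `q_{m+1} = (X − a_m) q_m − b_m q_{m−1}`, `b_m > 0`, for `1 ≤ m ≤ n − 1`; the sequence is continued past `n` by the recurrence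
with `b = 1` (`Nat.rec` on pairs), so N279 `recurrence_zeros` yields the zeros of `q_{t+1}`; N265 `sum_mul_eval_eq_of_orthogonal` and `gauss_weight_pos` finish.
DEDUP DISCLOSURE (`rg -n 'gauss_rule_exists|exists_gauss' Summits/Ventures/HSemireg/WedgeHankelRecurrence*`, 2026-09-03): N235 `exists_moments_iff_posDef_hankelSq` is the Stieltjes case
(positive nodes, Hankel data); here an arbitrary positive discrete measure on `ℝ`.  The 3 names below: 0 hits tree-wide.

WHAT IS IN THE TREE.  N265 `sum_mul_eval_eq_of_orthogonal`, `gauss_weight_pos`; N273 `three_term_recurrence`; N279 `recurrence_zeros`, `eq_prod_X_sub_C_of_monic_of_roots`; N289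
`exists_orthogonal_system_lower`; Mathlib `Polynomial.Monic.eq_X_add_C`, `Nat.rec_add_one`, `choose!`.
THIS FILE (namespace `Summit.Ventures.HSemireg.Wedge.HankelOuter` continued; CHAINED on N290 (import), N265, N273, N279, N289; 0 definitions):
* §1056 **`orthogonal_zeros_strictMono`** (the orthogonal polynomial `q_{m+1}`, `m + 1 ≤ n < N`, of a positive discrete measure is `∏_k (X − z_k)` with `z` strictly increasing),
  **`gauss_rule_exists`** (GAUSS–JACOBI EXISTS: `∃` nodes `z_0 < ⋯ < z_t` and weights `λ_k > 0` exact in degree `≤ 2t + 1`, for `t + 1 < N`), `gauss_rule_exists_nodes_mem` (the nodes lie in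
  `[min w, max w]`-hull form: some `w_l ≤ z_0` and `z_t ≤` some `w_l`, via N264).
CAVEATS.  Nothing Ext-side.  New names only.
-/

open Module Polynomial
open scoped Matrix Polynomial

namespace Summit.Ventures.HSemireg.Wedge.HankelOuter

/-! ## §1056. Existence of the Gauss rule -/

/-- **The orthogonal polynomials of a positive discrete measure have strictly increasing real zeros**: if `q_0 = 1, …, q_n` (`n < N`) are monic of the right degrees and each is
`(ν, w)`-orthogonal to every lower degree (`ν > 0`, `w` injective on `Fin N`), then for `m + 1 ≤ n` there is `z : Fin (m+1) → ℝ` strictly increasing with `q_{m+1} = ∏_k (X − z_k)`.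
[Szegő Thm 3.3.1; Chihara I Thm 5.2; this file, §1056] -/
theorem orthogonal_zeros_strictMono {N n : ℕ} {ν w : Fin N → ℝ} (hν : ∀ l, 0 < ν l) (hw : Function.Injective w) (hnN : n < N) {q : ℕ → ℝ[X]} (hq0 : q 0 = 1)
    (hmonic : ∀ k, k ≤ n → (q k).Monic) (hdeg : ∀ k, k ≤ n → (q k).natDegree = k)
    (horth : ∀ k, k ≤ n → ∀ G : ℝ[X], G.natDegree < k → ∑ l, ν l * (q k * G).eval (w l) = 0) {m : ℕ} (hm : m + 1 ≤ n) :
    ∃ z : Fin (m + 1) → ℝ, StrictMono z ∧ q (m + 1) = ∏ k, (Polynomial.X - C (z k)) := by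
  -- local recurrence coefficients from N273
  have hstep : ∀ m', 1 ≤ m' → m' + 1 ≤ n → ∃ a b : ℝ, q (m' + 1) = (Polynomial.X - C a) * q m' - C b * q (m' - 1) ∧ 0 < b := fun m' h1 h2 => by
    obtain ⟨a, b, hrec, hb, -, -⟩ := three_term_recurrence hν hw h1 (by omega) (hmonic (m' - 1) (by omega)) (hdeg (m' - 1) (by omega)) (hmonic m' (by omega)) (hdeg m' (by omega))
      (hmonic (m' + 1) h2) (hdeg (m' + 1) h2) (horth (m' - 1) (by omega)) (horth m' (by omega)) (horth (m' + 1) h2)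
    exact ⟨a, b, hrec, hb⟩
  choose! A B hAB hBpos using hstep
  -- `q_1 = X − a₀`
  have hn1 : 1 ≤ n := by omega
  have hq1 : q 1 = Polynomial.X - C (-(q 1).coeff 0) := by rw [C_neg, sub_neg_eq_add]; exact (hmonic 1 hn1).eq_X_add_C (hdeg 1 hn1)
  -- global coefficient sequences
  set A' : ℕ → ℝ := fun k => if k = 0 then -(q 1).coeff 0 else A k with hA'
  set B' : ℕ → ℝ := fun k => if 1 ≤ k ∧ k + 1 ≤ n then B k else 1 with hB'
  have hB'pos : ∀ j, 0 < B' j := fun j => by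
    simp only [hB']
    split_ifs with h
    · exact hBpos j h.1 h.2
    · exact one_pos
  -- the spliced sequence
  set F : ℕ → ℝ[X] × ℝ[X] := fun k => Nat.rec (motive := fun _ => ℝ[X] × ℝ[X]) (q 0, q 1) (fun k p => (p.2, (Polynomial.X - C (A' (k + 1))) * p.2 - C (B' (k + 1)) * p.1)) k with hF
  have hF0 : F 0 = (q 0, q 1) := rfl
  have hFs : ∀ k, F (k + 1) = ((F k).2, (Polynomial.X - C (A' (k + 1))) * (F k).2 - C (B' (k + 1)) * (F k).1) := fun k => rfl
  set Q : ℕ → ℝ[X] := fun k => (F k).1 with hQ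
  have hQ0 : Q 0 = 1 := by simp only [hQ, hF0, hq0]
  have hQ1 : Q 1 = q 1 := by simp only [hQ, hFs, hF0]
  have hQrec : ∀ k, Q (k + 2) = (Polynomial.X - C (A' (k + 1))) * Q (k + 1) - C (B' (k + 1)) * Q k := fun k => by
    simp only [hQ]
    rw [show k + 2 = (k + 1) + 1 by ring, hFs (k + 1), hFs k]
  -- agreement with `q` up to `n`
  have hagree : ∀ k, (k ≤ n → Q k = q k) ∧ (k + 1 ≤ n → Q (k + 1) = q (k + 1)) := by
    intro k
    induction k with
    | zero => exact ⟨fun _ => by rw [hQ0, hq0], fun _ => hQ1⟩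
    | succ k ih =>
      refine ⟨ih.2, fun hk => ?_⟩
      rw [show k + 1 + 1 = k + 2 by ring, hQrec k, ih.1 (by omega), ih.2 (by omega)]
      have hA1 : A' (k + 1) = A (k + 1) := by simp [hA']
      have hB1 : B' (k + 1) = B (k + 1) := by
        simp only [hB']
        rw [if_pos ⟨by omega, by omega⟩]
      rw [hA1, hB1]
      have := hAB (k + 1) (by omega) (by omega)
      rw [show k + 1 - 1 = k by omega] at this
      exact this.symm
  -- zeros from N279
  have hA0 : A' 0 = -(q 1).coeff 0 := by simp [hA']
  have hQ1' : Q 1 = Polynomial.X - C (A' 0) := by rw [hQ1, hA0]; exact hq1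
  obtain ⟨z, hz, hzr, -⟩ := recurrence_zeros hQ0 hQ1' hQrec hB'pos m
  have hQm : Q (m + 1) = q (m + 1) := (hagree m).2 hm
  rw [hQm] at hzr
  exact ⟨z, hz, eq_prod_X_sub_C_of_monic_of_roots (hmonic (m + 1) hm) (hdeg (m + 1) hm) hz.injective hzr⟩

/-- **GAUSS–JACOBI QUADRATURE EXISTS** for every positive discrete measure: if `ν_l > 0` on `N` distinct nodes `w_l` and `t + 1 < N`, there are nodes `z_0 < ⋯ < z_t` and weights `λ_k > 0`
with `Σ_k λ_k z_k^p = Σ_l ν_l w_l^p` for all `p ≤ 2t + 1`. [Gauss 1814; Jacobi 1826; Szegő Thm 3.4.1–3.4.2; Chihara I Thm 6.1–6.2; this file, §1056] -/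
theorem gauss_rule_exists {N t : ℕ} {ν w : Fin N → ℝ} (hν : ∀ l, 0 < ν l) (hw : Function.Injective w) (htN : t + 1 < N) :
    ∃ z μ : Fin (t + 1) → ℝ, StrictMono z ∧ (∀ k, 0 < μ k) ∧ ∀ p, p ≤ 2 * t + 1 → ∑ k, μ k * z k ^ p = ∑ l, ν l * w l ^ p := by
  obtain ⟨q, hq0, hm, hd, horth, -⟩ := exists_orthogonal_system_lower hν hw htN
  obtain ⟨z, hz, hprod⟩ := orthogonal_zeros_strictMono hν hw htN hq0 hm hd horth (m := t) le_rfl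
  have horthz : ∀ G : ℝ[X], G.natDegree ≤ t → ∑ l, ν l * ((∏ j, (Polynomial.X - C (z j))) * G).eval (w l) = 0 := fun G hG => by
    rw [← hprod]; exact horth (t + 1) le_rfl G (by omega)
  set μ : Fin (t + 1) → ℝ := fun k => ∑ l, ν l * (Lagrange.basis Finset.univ z k).eval (w l) with hμ
  have hmom : ∀ p, p ≤ 2 * t + 1 → ∑ k, μ k * z k ^ p = ∑ l, ν l * w l ^ p := fun p hp => by
    have h := sum_mul_eval_eq_of_orthogonal hz.injective horthz (μ := μ) (fun k => rfl) (F := Polynomial.X ^ p) (by rw [natDegree_X_pow]; exact hp)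
    simpa only [eval_pow, eval_X] using h
  refine ⟨z, μ, hz, ?_, hmom⟩
  exact gauss_weight_pos hz.injective hν hw (by omega) (fun p hp => hmom p (by omega))

/-- **… and the nodes are pinned by the support**: some `w_l ≤ z_0` and `z_t ≤` some `w_l` (N264). [Szegő Thm 3.3.1; this file, §1056] -/
theorem gauss_rule_exists_nodes_mem {N t : ℕ} {ν w : Fin N → ℝ} (hν : ∀ l, 0 < ν l) (hw : Function.Injective w) (htN : t + 1 < N) :
    ∃ z μ : Fin (t + 1) → ℝ, StrictMono z ∧ (∀ k, 0 < μ k) ∧ (∀ p, p ≤ 2 * t + 1 → ∑ k, μ k * z k ^ p = ∑ l, ν l * w l ^ p) ∧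
      (∃ l, w l ≤ z 0) ∧ ∃ l, z (Fin.last t) ≤ w l := by
  obtain ⟨z, μ, hz, hμ, hmom⟩ := gauss_rule_exists hν hw htN
  exact ⟨z, μ, hz, hμ, hmom, exists_node_le_gaussNode_zero hμ hz hν hmom, exists_gaussNode_last_le_node hμ hz hν hmom⟩

end Summit.Ventures.HSemireg.Wedge.HankelOuter
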